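import Literature.AlgebraicGeometry.HodgeTheory.CMHodgeGroupBlockedDualBases
import Literature.AlgebraicGeometry.HodgeTheory.UnitaryTypeSlotsHodgeClasses
import Literature.AlgebraicGeometry.Motives.HodgeStructureEndAlgPositiveInvolution
import HarnessLib

/-!
# Adapted `ψ_ℂ`-dual bases of `H¹ ⊗ ℂ = W_K ⊕ W̄_K` blocked by the eigenvalues of a SECOND Hodge endomorphism on `W_K`, for a CENTRAL `K = ℚ(φ)` and an ARBITRARY polarization (Deligne LNM 900 §4; Moonen–Zarhin 1999 §2 (2.3); Mumford §21: the Rosati involution is complex conjugation on a central imaginary quadratic `K`)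

Family `hodge`, layer `Literature/AlgebraicGeometry/HodgeTheory`, namespace `Literature.AlgebraicGeometry.Motives.HodgeStructure`.
THEOREMS ONLY: no definition, no named fact, no `sorry` (D-0026). Written for the cell `pub-hodgeav-hg6` (req-37 (A) Q2b,
TABLE X row 20 `Y₄ × E_K²`), seat eng-2 g8, brick «R20-S» part S2-T (lead g4 2026-08-29T08:45:11Z GO). HONEST FRAMING:
HC ∕ HC_AV (stmt-1333) ∕ HC_CM (stmt-3052) ∕ H2 are NOT proved and do not occur; this file is linear algebra on a
polarized Hodge structure of weight `1`.

WHAT. The tree's blocked letters S2 (`CMTheta.exists_blockedAdaptedDualBasis`) need `End_Hdg(V) = ℚ[φ]` — the Rosati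
involution of an ARBITRARY polarization `ψ` is then complex conjugation on `ℚ[φ]`, which makes non-conjugate eigenspaces
`ψ_ℂ`-orthogonal. On TABLE X row 20 (`A ∼ Y₄ × E_K²`, `End⁰(A) ⊇ K × M₂(K)`) this is false for the blocking endomorphism
`φ_E` (a generic element of a maximal commutative subalgebra), and only the DIAGONAL `K = ℚ(φ)` is central. This file
therefore asks for orthogonality only where it is available for every polarization:
* §1 **`Polarization.adjoint_eq_neg_of_forall_commute_of_mul_self_eq`** — a CENTRAL Hodge endomorphism `φ` with
  `φ² = −d` (`d > 0`) is `ψ`-skew for EVERY polarization `ψ`: `φ† = −φ` (Mumford §21 / Moonen §2.1: `†` is a positive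
  involution; here: `u = φφ†` is `†`-symmetric with `u² = d²`, Cauchy–Schwarz for the trace form `Tr(x†y)` bounds
  `Tr u ≤ d · dim V`, and `Tr((φ + φ†)†(φ + φ†)) = 2(Tr u − d · dim V) ≤ 0` forces `φ + φ† = 0`); hence
  `W_K = ker(φ_ℂ − i√d)` and `W̄_K` are `ψ_ℂ`-isotropic (`form_apply_add_form_apply_eq_zero_of_forall_commute`).
* §2 `BlockedTheta.linearIndependent_sigma_of_mem_eigenspace` — bases of distinct eigenspaces assemble to a linearly
  independent family (eigenvectors for distinct eigenvalues are independent).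
* §3 **`BlockedTheta.exists_adaptedDualBasis`** — for `H` effective polarized of weight `1`, `φ ∈ End_Hdg` `ψ`-skew with
  `φ² = −d`, `μ_K² = −d`, and a second `φ_E ∈ End_Hdg` with colours `μ : ι → ℂ` (injective) whose eigenspaces
  `W_{μ k}` decompose `W_K` (`W_{μ k} ≤ W_K ≤ ⨆_k W_{μ k}`): there are `N`, a basis `cb (t, ℓ)` of `V_ℂ`, kinds `κ`, a
  BLOCK MAP `blk : Fin N → ι`, with `cb (0, ℓ) ∈ W_{μ (blk ℓ)} ≤ W_K` Hodge-pure of the type recorded by `κ`,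
  `cb (1, ℓ) ∈ W̄_K` Hodge-pure of the opposite type, pairing table `ψ_ℂ(cb (0,i), cb (1,j)) = δ_{ij}`, same-type pairings
  `0`, and the letters of colour `k` SPANNING `W_{μ k}`. The type-`1` letters are the `ψ_ℂ`-DUALS inside `W̄_K` (perfect
  pairings `W_K^{1,0} × W̄_K^{0,1}`, `W_K^{0,1} × W̄_K^{1,0}` of the tree's `UnitaryTheta.pairing_bijective`); they are NOT
  asked to be `φ_E`-eigenvectors. Construction = the tree's B5a ∕ S2 construction (credited) with the type-`0` half
  assembled colour by colour.

## References
* [Deligne1982HodgeCycles] P. Deligne, LNM 900 (1982), §4 (p. 30).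
* [MoonenZarhin1999LowDim] B. Moonen, Yu. Zarhin, Math. Ann. 315 (1999), §2 (2.3).
* [MumfordAV1970] D. Mumford, *Abelian Varieties* (1970), §21 (positivity of the Rosati involution).
* [Moonen2017FamiliesMotives] B. Moonen, Milan J. Math. 85 (2017), §2.1 (p. 3).
* [Gordon1997] B. B. Gordon, arXiv:alg-geom/9709030, §6 (proof of Thm. 6.3.3, p. 19).
-/

noncomputable section

open scoped TensorProduct
open Module

namespace Literature.AlgebraicGeometry.Motives

namespace HodgeStructure

universe u

variable {V : Type u} [AddCommGroup V] [Module ℚ V] {n : ℤ}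

/-! ### §1 A central `φ` with `φ² = −d` is `ψ`-skew for every polarization -/

section CentralSkew

variable [Module.Finite ℚ V] {H : HodgeStructure V n}

/-- **The Rosati involution is complex conjugation on a CENTRAL imaginary quadratic `K = ℚ(φ) ⊆ End_Hdg`, for EVERY
polarization: `φ† = −φ`** when `φ ∈ End_Hdg(V)` commutes with every Hodge endomorphism and `φ² = −d`, `d > 0`. Proof:
`u := φφ†` is `†`-symmetric with `u² = d²`; positivity of the trace form `Tr(x†x) > 0` (`x ≠ 0`) on
`x = dim V · u − Tr(u) · 1` gives `Tr(u)² ≤ d² (dim V)²` (Cauchy–Schwarz), and on `x = φ + φ†` it gives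
`0 < Tr((φ + φ†)²) = 2 (Tr u − d · dim V) ≤ 0` unless `φ + φ† = 0`. [cite: MumfordAV1970, §21]
[cite: Moonen2017FamiliesMotives, §2.1 (p. 3)] -/
theorem Polarization.adjoint_eq_neg_of_forall_commute_of_mul_self_eq (ψ : H.Polarization) {φ : Module.End ℚ V}
    (hφE : φ ∈ H.endAlg) (hZ : ∀ a ∈ H.endAlg, φ * a = a * φ) {d : ℚ} (hd : 0 < d) (hφ2 : φ * φ = -(d • 1)) :
    ψ.adjoint φ = -φ := by
  -- the degenerate case `V = 0`
  by_cases h1 : (1 : Module.End ℚ V) = 0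
  · have hφ0 : φ = 0 := by rw [← one_mul φ, h1, zero_mul]
    rw [hφ0, ψ.adjoint_zero, neg_zero]
  have hφ'E : ψ.adjoint φ ∈ H.endAlg := ψ.adjoint_mem_endAlg hφE
  have hcomm : ψ.adjoint φ * φ = φ * ψ.adjoint φ := (hZ _ hφ'E).symm
  have hφ'2 : ψ.adjoint φ * ψ.adjoint φ = -(d • 1) := by
    have h := congrArg ψ.adjoint hφ2
    rwa [ψ.adjoint_mul, ← neg_smul, ψ.adjoint_smul, ψ.adjoint_one, neg_smul] at h
  -- `u = φ φ†`: `†`-symmetric, `u² = d²`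
  obtain ⟨u, hudef⟩ : ∃ u : Module.End ℚ V, u = φ * ψ.adjoint φ := ⟨_, rfl⟩
  have huE : u ∈ H.endAlg := by rw [hudef]; exact H.endAlg.mul_mem hφE hφ'E
  have hu_adj : ψ.adjoint u = u := by rw [hudef, ψ.adjoint_mul, ψ.adjoint_adjoint]
  have huu : u * u = (d * d) • (1 : Module.End ℚ V) := by
    rw [hudef]
    calc φ * ψ.adjoint φ * (φ * ψ.adjoint φ) = φ * (ψ.adjoint φ * φ) * ψ.adjoint φ := by noncomm_ring
      _ = φ * φ * (ψ.adjoint φ * ψ.adjoint φ) := by rw [hcomm]; noncomm_ring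
      _ = (d * d) • 1 := by rw [hφ2, hφ'2, neg_mul_neg, smul_mul_smul_comm, mul_one]
  obtain ⟨N, hNdef⟩ : ∃ N : ℚ, N = (Module.finrank ℚ V : ℚ) := ⟨_, rfl⟩
  obtain ⟨t, htdef⟩ : ∃ t : ℚ, t = LinearMap.trace ℚ V u := ⟨_, rfl⟩
  have htr1 : LinearMap.trace ℚ V (1 : Module.End ℚ V) = N := by rw [hNdef, LinearMap.trace_one]
  have hNpos : 0 < N := by
    have h := ψ.trace_adjoint_mul_self_pos H.endAlg.one_mem h1
    rwa [ψ.adjoint_one, mul_one, htr1] at h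
  -- Cauchy–Schwarz for the trace form on `b = N u − t 1`: `t² ≤ d² N²`
  obtain ⟨b, hbdef⟩ : ∃ b : Module.End ℚ V, b = N • u - t • 1 := ⟨_, rfl⟩
  have hbE : b ∈ H.endAlg := by
    rw [hbdef]; exact H.endAlg.sub_mem (H.endAlg.smul_mem huE N) (H.endAlg.smul_mem H.endAlg.one_mem t)
  have hb_adj : ψ.adjoint b = b := by
    rw [hbdef, sub_eq_add_neg, ← neg_smul, ψ.adjoint_add, ψ.adjoint_smul, ψ.adjoint_smul, ψ.adjoint_one, hu_adj]
  have hbb' : b * b = (N * N * (d * d) + t * t) • (1 : Module.End ℚ V) - (2 * N * t) • u := by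
    rw [hbdef, sub_mul, mul_sub, mul_sub, smul_mul_smul_comm, smul_mul_smul_comm, smul_mul_smul_comm,
      smul_mul_smul_comm, huu, mul_one, one_mul, mul_one, smul_smul]
    module
  have hbb : LinearMap.trace ℚ V (ψ.adjoint b * b) = N * (N * N * (d * d) - t * t) := by
    rw [hb_adj, hbb', map_sub, map_smul, map_smul, htr1, ← htdef, smul_eq_mul, smul_eq_mul]
    ring
  have hCS : 0 ≤ N * (N * N * (d * d) - t * t) := by
    by_cases hb0 : b = 0
    · have h : LinearMap.trace ℚ V (ψ.adjoint b * b) = 0 := by rw [hb0, mul_zero, map_zero]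
      rw [← hbb, h]
    · rw [← hbb]; exact (ψ.trace_adjoint_mul_self_pos hbE hb0).le
  have ht : t ≤ d * N := by
    have h0 : 0 ≤ N * N * (d * d) - t * t := by
      by_contra h
      exact absurd hCS (not_le.2 (mul_neg_of_pos_of_neg hNpos (not_le.1 h)))
    by_contra hlt
    have hlt' : d * N < t := not_le.1 hlt
    have hsq : d * N * (d * N) < t * t := mul_self_lt_mul_self (mul_pos hd hNpos).le hlt'
    nlinarith [hsq, h0]
  -- positivity of the trace form on `a = φ + φ†`: `Tr(a†a) = 2 (t − d N) ≤ 0`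
  obtain ⟨a, hadef⟩ : ∃ a : Module.End ℚ V, a = φ + ψ.adjoint φ := ⟨_, rfl⟩
  have haE : a ∈ H.endAlg := by rw [hadef]; exact H.endAlg.add_mem hφE hφ'E
  have ha_adj : ψ.adjoint a = a := by rw [hadef, ψ.adjoint_add, ψ.adjoint_adjoint, add_comm]
  have haa' : a * a = (2 : ℚ) • u - (2 * d) • (1 : Module.End ℚ V) := by
    rw [hadef, add_mul, mul_add, mul_add, hφ2, hφ'2, hcomm, ← hudef]
    module
  have haa : LinearMap.trace ℚ V (ψ.adjoint a * a) = 2 * (t - d * N) := by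
    rw [ha_adj, haa', map_sub, map_smul, map_smul, htr1, ← htdef, smul_eq_mul, smul_eq_mul]
    ring
  by_cases ha0 : a = 0
  · have h0 : φ + ψ.adjoint φ = 0 := by rw [← hadef]; exact ha0
    exact eq_neg_of_add_eq_zero_right h0
  · exfalso
    have hpos := ψ.trace_adjoint_mul_self_pos haE ha0
    rw [haa] at hpos
    linarith

/-- A central `φ ∈ End_Hdg` with `φ² = −d`, `d > 0`, is `ψ`-SKEW for every polarization: `ψ(φ v, w) + ψ(v, φ w) = 0`
(so `W_K` and `W̄_K` are `ψ_ℂ`-isotropic, `UnitaryTheta.form_eq_zero_of_mem_eigenspace`). [cite: MumfordAV1970, §21]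
[cite: MoonenZarhin1999LowDim, §2 (2.3)] -/
theorem Polarization.form_apply_add_form_apply_eq_zero_of_forall_commute (ψ : H.Polarization)
    {φ : Module.End ℚ V} (hφE : φ ∈ H.endAlg) (hZ : ∀ a ∈ H.endAlg, φ * a = a * φ) {d : ℚ} (hd : 0 < d)
    (hφ2 : φ * φ = -(d • 1)) (v w : V) : ψ.form (φ v) w + ψ.form v (φ w) = 0 := by
  rw [← ψ.form_apply_adjoint φ v w, ψ.adjoint_eq_neg_of_forall_commute_of_mul_self_eq hφE hZ hd hφ2,
    LinearMap.neg_apply, map_neg, neg_add_cancel]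

end CentralSkew

/-! ### §2 Bases of distinct eigenspaces assemble to a linearly independent family -/

section EigenSigma

/-- **Bases of DISTINCT eigenspaces of one operator form a linearly independent family** (a vanishing combination has
vanishing component in each eigenspace — eigenvectors for distinct eigenvalues are independent — and each component
is a combination of a basis). [cite: Gordon1997, §6 (proof of Thm. 6.3.3, p. 19)] -/
theorem BlockedTheta.linearIndependent_sigma_of_mem_eigenspace {M : Type*} [AddCommGroup M] [Module ℂ M]
    {ι : Type} [Fintype ι] (f : Module.End ℂ M) {μ : ι → ℂ} (hinj : Function.Injective μ) {a : ι → ℕ}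
    (b : ∀ k, Fin (a k) → M) (hb : ∀ k, LinearIndependent ℂ (b k))
    (hmem : ∀ k i, b k i ∈ Module.End.eigenspace f (μ k)) :
    LinearIndependent ℂ fun x : (Σ k, Fin (a k)) => b x.1 x.2 := by
  classical
  rw [Fintype.linearIndependent_iff]
  intro c hc
  -- the component of colour `k`
  set s : ι → M := fun k => ∑ i, c ⟨k, i⟩ • b k i with hsdef
  have hs_mem : ∀ k, s k ∈ Module.End.eigenspace f (μ k) := fun k =>
    Submodule.sum_mem _ fun i _ => Submodule.smul_mem _ _ (hmem k i)
  have hsum : ∑ k, s k = 0 := by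
    rw [← hc, ← Finset.univ_sigma_univ, Finset.sum_sigma]
  -- every component vanishes: the non-zero ones would be independent eigenvectors summing to zero
  have hs0 : ∀ k, s k = 0 := by
    intro k
    by_contra hk
    have hli : LinearIndependent ℂ fun j : {k' : ι // s k' ≠ 0} => s j.1 :=
      Module.End.eigenvectors_linearIndependent' f (fun j : {k' : ι // s k' ≠ 0} => μ j.1)
        (fun j j' h => Subtype.ext (hinj h)) (fun j : {k' : ι // s k' ≠ 0} => s j.1) fun j => ⟨hs_mem j.1, j.2⟩
    have hsumJ : ∑ j : {k' : ι // s k' ≠ 0}, (1 : ℂ) • s j.1 = 0 := by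
      simp only [one_smul]
      have h1 : ∑ k' ∈ Finset.univ.filter (fun k' => s k' ≠ 0), s k' = ∑ k', s k' :=
        Finset.sum_filter_ne_zero _
      have h2 : ∑ k' ∈ Finset.univ.filter (fun k' => s k' ≠ 0), s k' = ∑ j : {k' : ι // s k' ≠ 0}, s j.1 :=
        Finset.sum_subtype _ (fun k' => by simp) s
      rw [← h2, h1, hsum]
    have h1 := Fintype.linearIndependent_iff.1 hli (fun _ => (1 : ℂ)) hsumJ ⟨k, hk⟩
    exact one_ne_zero h1
  rintro ⟨k, i⟩
  exact Fintype.linearIndependent_iff.1 (hb k) (fun i' => c ⟨k, i'⟩) (hs0 k) i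

end EigenSigma

/-! ### §3 The blocked adapted dual letters -/

section TiedDualBases

/-- The two elements of `Fin 2`. [folklore] -/
private theorem BlockedTheta.fin2_cases (r : Fin 2) : r = 0 ∨ r = 1 := by
  fin_cases r <;> simp

/-- **Adapted `ψ_ℂ`-dual letters of `V_ℂ = W_K ⊕ W̄_K`, the `W_K`-letters blocked by a second Hodge endomorphism
`φ_E`, for an ARBITRARY polarization.** Data: `H` effective polarized of weight `1`; `φ ∈ End_Hdg(V)` `ψ`-SKEW (e.g.
central, §1) with `φ² = −d`, `d > 0`, `μ_K² = −d`; `φ_E ∈ End_Hdg(V)` with colours `μ : ι → ℂ` (injective) such that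
`W_{μ k}(φ_E) ≤ W_K := ker(φ_ℂ − μ_K) ≤ ⨆_k W_{μ k}(φ_E)`. Then there are `N`, a basis `cb (t, ℓ)` (`t : Fin 2`, `ℓ : Fin N`)
of `V_ℂ`, kinds `κ : Fin N → Fin 2` and a BLOCK MAP `blk : Fin N → ι` with: `cb (0, ℓ) ∈ W_{μ (blk ℓ)}(φ_E)`, `cb (0, ℓ) ∈ W_K`,
`cb (1, ℓ) ∈ W̄_K = ker(φ_ℂ + μ_K)`; `cb (0,ℓ) ∈ V^{1,0}, cb (1,ℓ) ∈ V^{0,1}` for `κ ℓ = 0` and the opposite types for `κ ℓ = 1`;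
`ψ_ℂ(cb (0,i), cb (1,j)) = δ_{ij}`, `ψ_ℂ = 0` on two letters of the same type; and for every colour `k` the letters
`cb (0, ℓ)`, `blk ℓ = k`, SPAN `W_{μ k}(φ_E)`. (Type-`0` letters: Hodge-pure bases of the `W_{μ k}` — `φ_E` commutes with the
Hodge operator `Θ`; type-`1` letters: their `ψ_ℂ`-duals in `W̄_K` through the perfect pairings
`W_K^{1,0} × W̄_K^{0,1}`, `W_K^{0,1} × W̄_K^{1,0}` of `UnitaryTheta.pairing_bijective`; independence by the pairing table,
spanning by `V_ℂ = W_K ⊕ W̄_K` and the `Θ`-grading — the tree's B5a ∕ S2 construction, credited.)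
[cite: Deligne1982HodgeCycles, §4 (p. 30)] [cite: MoonenZarhin1999LowDim, §2 (2.3)]
[cite: Gordon1997, §6 (proof of Thm. 6.3.3, p. 19)] -/
theorem BlockedTheta.exists_adaptedDualBasis [Module.Finite ℚ V] [HodgeTensorFacts.{u, u}] {ι : Type} [Fintype ι]
    [DecidableEq ι] (H : HodgeStructure V n) (hn : n = 1) (heff : H.IsEffective) (ψ : H.Polarization)
    {φ : Module.End ℚ V} (hφE : φ ∈ H.endAlg) {d : ℚ} (hd : 0 < d) (hφ2 : φ * φ = -(d • 1))
    (hφskew : ∀ v w, ψ.form (φ v) w + ψ.form v (φ w) = 0) {μK : ℂ} (hμ : μK ^ 2 = -(d : ℂ))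
    {φE : Module.End ℚ V} (hφEE : φE ∈ H.endAlg) (μ : ι → ℂ) (hinj : Function.Injective μ)
    (hKle : ∀ k, Module.End.eigenspace (φE.baseChange ℂ) (μ k) ≤ Module.End.eigenspace (φ.baseChange ℂ) μK)
    (hKge : Module.End.eigenspace (φ.baseChange ℂ) μK ≤ ⨆ k, Module.End.eigenspace (φE.baseChange ℂ) (μ k)) :
    ∃ (N : ℕ) (cb : Module.Basis (Fin 2 × Fin N) ℂ (ℂ ⊗[ℚ] V)) (κ : Fin N → Fin 2) (blk : Fin N → ι),
      (∀ ℓ, cb (0, ℓ) ∈ Module.End.eigenspace (φE.baseChange ℂ) (μ (blk ℓ))) ∧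
      (∀ ℓ, cb (0, ℓ) ∈ Module.End.eigenspace (φ.baseChange ℂ) μK) ∧
      (∀ ℓ, cb (1, ℓ) ∈ Module.End.eigenspace (φ.baseChange ℂ) (-μK)) ∧
      (∀ ℓ, κ ℓ = 0 → cb (0, ℓ) ∈ H.piece 1 0 ∧ cb (1, ℓ) ∈ H.piece 0 1) ∧
      (∀ ℓ, κ ℓ = 1 → cb (0, ℓ) ∈ H.piece 0 1 ∧ cb (1, ℓ) ∈ H.piece 1 0) ∧
      (∀ i j, ψ.form.baseChange ℂ (cb (0, i)) (cb (1, j)) = if i = j then 1 else 0) ∧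
      (∀ (t : Fin 2) i j, ψ.form.baseChange ℂ (cb (t, i)) (cb (t, j)) = 0) ∧
      (∀ k, Module.End.eigenspace (φE.baseChange ℂ) (μ k) ≤
        Submodule.span ℂ (Set.range fun ℓ : {ℓ : Fin N // blk ℓ = k} => cb (0, ℓ.1))) := by
  classical
  subst hn
  obtain ⟨Θ, hΘ⟩ := exists_hodgeTheta H
  obtain ⟨hP, hQ, hΘ10, hΘ01, -⟩ := UnitaryTheta.theta_facts H rfl heff hΘ
  obtain ⟨hμ0, hμc⟩ := UnitaryTheta.conj_eq_neg_of_sq hd hμ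
  set φC := φ.baseChange ℂ with hφC
  set φEC := φE.baseChange ℂ with hφEC
  set W := Module.End.eigenspace φC μK with hWdef
  set W' := Module.End.eigenspace φC (-μK) with hW'def
  set ψC := ψ.form.baseChange ℂ with hψC
  -- `Θ` preserves `W`, `W'`, `W_{μ k}`; isotropy of `W`, `W'`
  have hΘφ : Θ * φC = φC * Θ :=
    commute_baseChange_of_mem_hodgeLieC H (H.mem_hodgeLieC_of_forall_piece hΘ) ⟨φ, hφE⟩
  have hΘφE : Θ * φEC = φEC * Θ :=
    commute_baseChange_of_mem_hodgeLieC H (H.mem_hodgeLieC_of_forall_piece hΘ) ⟨φE, hφEE⟩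
  have hΘW : ∀ w ∈ W, Θ w ∈ W := fun w hw => UnitaryTheta.apply_mem_eigenspace_of_commute hΘφ hw
  have hΘW' : ∀ w ∈ W', Θ w ∈ W' := fun w hw => UnitaryTheta.apply_mem_eigenspace_of_commute hΘφ hw
  have hΘWk : ∀ k, ∀ w ∈ Module.End.eigenspace φEC (μ k), Θ w ∈ Module.End.eigenspace φEC (μ k) :=
    fun k w hw => UnitaryTheta.apply_mem_eigenspace_of_commute hΘφE hw
  have hφskewC : ∀ x y, ψC (φC x) y + ψC x (φC y) = 0 :=
    ThetaSubalgebra.formBaseChange_add_eq_zero_of_skew ψ hφskew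
  have hisoW : ∀ x ∈ W, ∀ y ∈ W, ψC x y = 0 := fun x hx y hy =>
    UnitaryTheta.form_eq_zero_of_mem_eigenspace hφskewC hμ0 hx hy
  have hisoW' : ∀ x ∈ W', ∀ y ∈ W', ψC x y = 0 := fun x hx y hy =>
    UnitaryTheta.form_eq_zero_of_mem_eigenspace hφskewC (neg_ne_zero.2 hμ0) hx hy
  have h1100 : ∀ x ∈ H.piece 1 0, ∀ y ∈ H.piece 1 0, ψC x y = 0 := fun x hx y hy =>
    ψ.form_piece_piece (p := 1) (p' := 1) (by norm_num) (by simpa using hx) (by simpa using hy)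
  have h0101 : ∀ x ∈ H.piece 0 1, ∀ y ∈ H.piece 0 1, ψC x y = 0 := fun x hx y hy =>
    ψ.form_piece_piece (p := 0) (p' := 0) (by norm_num) (by simpa using hx) (by simpa using hy)
  -- the graded pieces of each colour and their bases
  set U₁ : ι → Submodule ℂ (ℂ ⊗[ℚ] V) := fun k => Module.End.eigenspace φEC (μ k) ⊓ H.piece 1 0 with hU₁def
  set U₂ : ι → Submodule ℂ (ℂ ⊗[ℚ] V) := fun k => Module.End.eigenspace φEC (μ k) ⊓ H.piece 0 1 with hU₂def
  set a : ι → ℕ := fun k => Module.finrank ℂ ↥(U₁ k) with hadef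
  set b : ι → ℕ := fun k => Module.finrank ℂ ↥(U₂ k) with hbdef
  set b₁ : ∀ k, Module.Basis (Fin (a k)) ℂ ↥(U₁ k) := fun k => Module.finBasis ℂ ↥(U₁ k) with hb₁def
  set b₂ : ∀ k, Module.Basis (Fin (b k)) ℂ ↥(U₂ k) := fun k => Module.finBasis ℂ ↥(U₂ k) with hb₂def
  -- the `W_K`-pieces `W₁ = W ∩ V^{1,0}`, `L = W ∩ V^{0,1}` and their partners in `W̄_K`
  set W₁ := W ⊓ H.piece 1 0 with hW₁def
  set L := W ⊓ H.piece 0 1 with hLdef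
  set W₁' := W' ⊓ H.piece 0 1 with hW₁'def
  set L' := W' ⊓ H.piece 1 0 with hL'def
  -- the assembled type-`0` families are bases of `W₁`, `L`
  set e₁ : (Σ k, Fin (a k)) → ℂ ⊗[ℚ] V := fun x => (b₁ x.1 x.2 : ℂ ⊗[ℚ] V) with he₁def
  set e₂ : (Σ k, Fin (b k)) → ℂ ⊗[ℚ] V := fun x => (b₂ x.1 x.2 : ℂ ⊗[ℚ] V) with he₂def
  have he₁mem : ∀ x, e₁ x ∈ W₁ := fun x => ⟨hKle _ (b₁ x.1 x.2).2.1, (b₁ x.1 x.2).2.2⟩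
  have he₂mem : ∀ x, e₂ x ∈ L := fun x => ⟨hKle _ (b₂ x.1 x.2).2.1, (b₂ x.1 x.2).2.2⟩
  have he₁li : LinearIndependent ℂ e₁ :=
    BlockedTheta.linearIndependent_sigma_of_mem_eigenspace φEC hinj (fun k i => (b₁ k i : ℂ ⊗[ℚ] V))
      (fun k => (b₁ k).linearIndependent.map' (U₁ k).subtype (Submodule.ker_subtype _)) fun k i => (b₁ k i).2.1
  have he₂li : LinearIndependent ℂ e₂ :=
    BlockedTheta.linearIndependent_sigma_of_mem_eigenspace φEC hinj (fun k i => (b₂ k i : ℂ ⊗[ℚ] V))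
      (fun k => (b₂ k).linearIndependent.map' (U₂ k).subtype (Submodule.ker_subtype _)) fun k i => (b₂ k i).2.1
  -- spanning of the colour pieces by their bases (in `V_ℂ`)
  have hspanU : ∀ (S : Submodule ℂ (ℂ ⊗[ℚ] V)) {m : ℕ} (bS : Module.Basis (Fin m) ℂ S) (x : ℂ ⊗[ℚ] V), x ∈ S →
      x ∈ Submodule.span ℂ (Set.range fun i => (bS i : ℂ ⊗[ℚ] V)) := by
    intro S m bS x hx
    have h := congrArg Subtype.val (bS.sum_repr ⟨x, hx⟩)
    simp only [Submodule.coe_sum, Submodule.coe_smul] at h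
    rw [← h]
    exact Submodule.sum_mem _ fun i _ => Submodule.smul_mem _ _ (Submodule.subset_span ⟨i, rfl⟩)
  -- every `w ∈ W` splits along the colours and the `Θ`-grading into the pieces `U₁ k`, `U₂ k`
  have hWsplit : ∀ w ∈ W, (2 : ℂ)⁻¹ • (w + Θ w) ∈ Submodule.span ℂ (Set.range e₁) ∧
      (2 : ℂ)⁻¹ • (w - Θ w) ∈ Submodule.span ℂ (Set.range e₂) := by
    intro w hw
    have hw' : w ∈ ⨆ k, Module.End.eigenspace φEC (μ k) := hKge hw
    refine Submodule.iSup_induction _ (motive := fun x => (2 : ℂ)⁻¹ • (x + Θ x) ∈ Submodule.span ℂ (Set.range e₁) ∧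
      (2 : ℂ)⁻¹ • (x - Θ x) ∈ Submodule.span ℂ (Set.range e₂)) hw' (fun k x hx => ?_)
      (by simp) (fun x y hx hy => ?_)
    · have hPx : (2 : ℂ)⁻¹ • (x + Θ x) ∈ U₁ k :=
        ⟨Submodule.smul_mem _ _ (Submodule.add_mem _ hx (hΘWk k x hx)), hP x⟩
      have hQx : (2 : ℂ)⁻¹ • (x - Θ x) ∈ U₂ k :=
        ⟨Submodule.smul_mem _ _ (Submodule.sub_mem _ hx (hΘWk k x hx)), hQ x⟩
      refine ⟨?_, ?_⟩
      · refine Submodule.span_mono ?_ (hspanU (U₁ k) (b₁ k) _ hPx)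
        rintro _ ⟨i, rfl⟩
        exact ⟨⟨k, i⟩, rfl⟩
      · refine Submodule.span_mono ?_ (hspanU (U₂ k) (b₂ k) _ hQx)
        rintro _ ⟨i, rfl⟩
        exact ⟨⟨k, i⟩, rfl⟩
    · have e1 : (2 : ℂ)⁻¹ • (x + y + Θ (x + y)) = (2 : ℂ)⁻¹ • (x + Θ x) + (2 : ℂ)⁻¹ • (y + Θ y) := by
        rw [map_add]; module
      have e2 : (2 : ℂ)⁻¹ • (x + y - Θ (x + y)) = (2 : ℂ)⁻¹ • (x - Θ x) + (2 : ℂ)⁻¹ • (y - Θ y) := by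
        rw [map_add]; module
      rw [e1, e2]
      exact ⟨Submodule.add_mem _ hx.1 hy.1, Submodule.add_mem _ hx.2 hy.2⟩
  -- bases of `W₁`, `L` indexed by the sigma types
  have hmk : ∀ (S : Submodule ℂ (ℂ ⊗[ℚ] V)) {J : Type} (e : J → ℂ ⊗[ℚ] V) (hmem : ∀ x, e x ∈ S)
      (hli : LinearIndependent ℂ e) (hsp : ∀ x ∈ S, x ∈ Submodule.span ℂ (Set.range e)),
      ∃ bS : Module.Basis J ℂ S, ∀ x, (bS x : ℂ ⊗[ℚ] V) = e x := by
    intro S J e hmem hli hsp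
    set e' : J → S := fun x => ⟨e x, hmem x⟩ with he'
    have hli' : LinearIndependent ℂ e' :=
      LinearIndependent.of_comp S.subtype (show LinearIndependent ℂ (S.subtype ∘ e') from hli)
    have hsp' : ⊤ ≤ Submodule.span ℂ (Set.range e') := by
      rintro ⟨x, hx⟩ -
      have h := hsp x hx
      rw [show Set.range e = S.subtype '' Set.range e' by
        rw [← Set.range_comp]; rfl] at h
      exact (Submodule.apply_mem_span_image_iff_mem_span S.injective_subtype).1 h
    exact ⟨Module.Basis.mk hli' hsp', fun x => by rw [Module.Basis.mk_apply]⟩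
  have hW₁sp : ∀ x ∈ W₁, x ∈ Submodule.span ℂ (Set.range e₁) := by
    rintro x ⟨hxW, hx10⟩
    have h := (hWsplit x hxW).1
    rwa [hΘ10 x hx10, ← two_smul ℂ x, smul_smul, inv_mul_cancel₀ two_ne_zero, one_smul] at h
  have hLsp : ∀ x ∈ L, x ∈ Submodule.span ℂ (Set.range e₂) := by
    rintro x ⟨hxW, hx01⟩
    have h := (hWsplit x hxW).2
    rwa [hΘ01 x hx01, sub_neg_eq_add, ← two_smul ℂ x, smul_smul, inv_mul_cancel₀ two_ne_zero, one_smul] at h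
  obtain ⟨B₁, hB₁⟩ := hmk W₁ e₁ he₁mem he₁li hW₁sp
  obtain ⟨B₂, hB₂⟩ := hmk L e₂ he₂mem he₂li hLsp
  -- the dual letters in `W̄_K` through the perfect pairings
  set Φ₁ := LinearEquiv.ofBijective _ (UnitaryTheta.pairing_bijective H rfl ψ φ hd hμ 1 0 (by norm_num)) with hΦ₁def
  set Φ₂ := LinearEquiv.ofBijective _ (UnitaryTheta.pairing_bijective H rfl ψ φ hd hμ 0 1 (by norm_num)) with hΦ₂def
  have hΦ₁ : ∀ (y' : W₁') (x : W₁), Φ₁ y' x = ψC x y' := fun y' x => by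
    rw [hΦ₁def, LinearEquiv.ofBijective_apply, LinearMap.flip_apply, LinearMap.domRestrict₁₂_apply]
  have hΦ₂ : ∀ (y' : L') (x : L), Φ₂ y' x = ψC x y' := fun y' x => by
    rw [hΦ₂def, LinearEquiv.ofBijective_apply, LinearMap.flip_apply, LinearMap.domRestrict₁₂_apply]
  set fb₁ : Module.Basis _ ℂ W₁' := B₁.dualBasis.map Φ₁.symm with hfb₁def
  set fb₂ : Module.Basis _ ℂ L' := B₂.dualBasis.map Φ₂.symm with hfb₂def
  have hfb₁ : ∀ i (x : W₁), ψC x (fb₁ i) = B₁.repr x i := fun i x => by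
    rw [← hΦ₁, hfb₁def, Module.Basis.map_apply, LinearEquiv.apply_symm_apply, Module.Basis.dualBasis_apply]
  have hfb₂ : ∀ i (x : L), ψC x (fb₂ i) = B₂.repr x i := fun i x => by
    rw [← hΦ₂, hfb₂def, Module.Basis.map_apply, LinearEquiv.apply_symm_apply, Module.Basis.dualBasis_apply]
  -- the combined families, indexed by `Λ = (Σ k, Fin (a k)) ⊕ (Σ k, Fin (b k))`
  set e : (Σ k, Fin (a k)) ⊕ (Σ k, Fin (b k)) → ℂ ⊗[ℚ] V := Sum.elim e₁ e₂ with hedef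
  set f : (Σ k, Fin (a k)) ⊕ (Σ k, Fin (b k)) → ℂ ⊗[ℚ] V :=
    Sum.elim (fun i => (fb₁ i : ℂ ⊗[ℚ] V)) (fun j => (fb₂ j : ℂ ⊗[ℚ] V)) with hfdef
  set κ₀ : (Σ k, Fin (a k)) ⊕ (Σ k, Fin (b k)) → Fin 2 := Sum.elim (fun _ => 0) (fun _ => 1) with hκ₀def
  set blk₀ : (Σ k, Fin (a k)) ⊕ (Σ k, Fin (b k)) → ι := Sum.elim (fun x => x.1) (fun x => x.1) with hblk₀def
  have heE : ∀ s, e s ∈ Module.End.eigenspace φEC (μ (blk₀ s)) := by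
    rintro (x | x); exacts [(b₁ x.1 x.2).2.1, (b₂ x.1 x.2).2.1]
  have heW : ∀ s, e s ∈ W := by
    rintro (x | x); exacts [(he₁mem x).1, (he₂mem x).1]
  have hfW' : ∀ s, f s ∈ W' := by
    rintro (i | j); exacts [(fb₁ i).2.1, (fb₂ j).2.1]
  have he0 : ∀ s, κ₀ s = 0 → e s ∈ H.piece 1 0 ∧ f s ∈ H.piece 0 1 := by
    rintro (i | j) h
    · exact ⟨(he₁mem i).2, (fb₁ i).2.2⟩
    · simp [hκ₀def] at h
  have he1 : ∀ s, κ₀ s = 1 → e s ∈ H.piece 0 1 ∧ f s ∈ H.piece 1 0 := by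
    rintro (i | j) h
    · simp [hκ₀def] at h
    · exact ⟨(he₂mem j).2, (fb₂ j).2.2⟩
  have hdual : ∀ s s', ψC (e s) (f s') = if s = s' then 1 else 0 := by
    rintro (i | i) (j | j)
    · change ψC (e₁ i) (fb₁ j) = _
      rw [← hB₁ i, hfb₁, Module.Basis.repr_self, Finsupp.single_apply]
      by_cases h : i = j
      · subst h; simp
      · rw [if_neg h, if_neg (fun h' => h (Sum.inl_injective h'))]
    · change ψC (e₁ i) (fb₂ j) = _
      rw [h1100 _ (he₁mem i).2 _ (fb₂ j).2.2, if_neg Sum.inl_ne_inr]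
    · change ψC (e₂ i) (fb₁ j) = _
      rw [h0101 _ (he₂mem i).2 _ (fb₁ j).2.2, if_neg Sum.inr_ne_inl]
    · change ψC (e₂ i) (fb₂ j) = _
      rw [← hB₂ i, hfb₂, Module.Basis.repr_self, Finsupp.single_apply]
      by_cases h : i = j
      · subst h; simp
      · rw [if_neg h, if_neg (fun h' => h (Sum.inr_injective h'))]
  set cbf : Fin 2 × ((Σ k, Fin (a k)) ⊕ (Σ k, Fin (b k))) → ℂ ⊗[ℚ] V :=
    fun tl => if tl.1 = 0 then e tl.2 else f tl.2 with hcbfdef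
  have hcbf0 : ∀ s, cbf (0, s) = e s := fun s => by simp [hcbfdef]
  have hcbf1 : ∀ s, cbf (1, s) = f s := fun s => by simp [hcbfdef]
  -- linear independence by duality
  have hli : LinearIndependent ℂ cbf := by
    rw [Fintype.linearIndependent_iff]
    intro c hc
    rw [Fintype.sum_prod_type, Fin.sum_univ_two] at hc
    simp only [hcbf0, hcbf1] at hc
    have hxW : ∑ s, c (0, s) • e s ∈ W := Submodule.sum_mem _ fun s _ => Submodule.smul_mem _ _ (heW s)
    have hyW' : ∑ s, c (1, s) • f s ∈ W' := Submodule.sum_mem _ fun s _ => Submodule.smul_mem _ _ (hfW' s)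
    have hx0 : ∑ s, c (0, s) • e s = 0 := by
      refine UnitaryTheta.eq_zero_of_mem_eigenspace_of_mem_eigenspace_neg hμ0 hxW ?_
      have h : ∑ s, c (0, s) • e s = -∑ s, c (1, s) • f s := eq_neg_of_add_eq_zero_left hc
      rw [h]
      exact Submodule.neg_mem _ hyW'
    have hy0 : ∑ s, c (1, s) • f s = 0 := by rwa [hx0, zero_add] at hc
    rintro ⟨t, s⟩
    rcases Fin.eq_zero_or_eq_succ t with rfl | ⟨j, rfl⟩
    · have h := congrArg (fun z => ψC z (f s)) hx0
      simp only [map_sum, map_smul, LinearMap.sum_apply, LinearMap.smul_apply, smul_eq_mul, hdual,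
        mul_ite, mul_one, mul_zero, Finset.sum_ite_eq', Finset.mem_univ, if_true, map_zero,
        LinearMap.zero_apply] at h
      exact h
    · obtain rfl : j = 0 := Fin.eq_zero j
      have h := congrArg (fun z => ψC (e s) z) hy0
      simp only [map_sum, map_smul, smul_eq_mul, hdual, mul_ite, mul_one, mul_zero, Finset.sum_ite_eq,
        Finset.mem_univ, if_true, map_zero] at h
      exact h
  -- spanning: `V_ℂ = W ⊕ W'`, `W` through `hWsplit`, `W' = L' ⊕ W₁'`
  have hspan : ⊤ ≤ Submodule.span ℂ (Set.range cbf) := by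
    rintro v -
    have hsub : ∀ (S : Submodule ℂ (ℂ ⊗[ℚ] V)) {ι' : Type} [Fintype ι'] (bS : Module.Basis ι' ℂ S)
        (emb : ι' → Fin 2 × ((Σ k, Fin (a k)) ⊕ (Σ k, Fin (b k)))) (hemb : ∀ i, cbf (emb i) = bS i)
        (x : ℂ ⊗[ℚ] V) (hx : x ∈ S), x ∈ Submodule.span ℂ (Set.range cbf) := by
      intro S ι' _ bS emb hemb x hx
      have h := congrArg Subtype.val (bS.sum_repr ⟨x, hx⟩)
      simp only [Submodule.coe_sum, Submodule.coe_smul] at h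
      rw [← h]
      refine Submodule.sum_mem _ fun i _ => Submodule.smul_mem _ _ ?_
      rw [← hemb]
      exact Submodule.subset_span ⟨emb i, rfl⟩
    have hrange0 : ∀ s, e s ∈ Submodule.span ℂ (Set.range cbf) := fun s => by
      rw [← hcbf0]; exact Submodule.subset_span ⟨(0, s), rfl⟩
    have hspan₁ : Submodule.span ℂ (Set.range e₁) ≤ Submodule.span ℂ (Set.range cbf) := by
      refine Submodule.span_le.2 ?_
      rintro _ ⟨x, rfl⟩
      exact hrange0 (Sum.inl x)
    have hspan₂ : Submodule.span ℂ (Set.range e₂) ≤ Submodule.span ℂ (Set.range cbf) := by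
      refine Submodule.span_le.2 ?_
      rintro _ ⟨x, rfl⟩
      exact hrange0 (Sum.inr x)
    obtain ⟨w, hw, w', hw', rfl⟩ := UnitaryTheta.exists_eigen_add_eigen hφ2 hμ hμ0 v
    have hPw' : (2 : ℂ)⁻¹ • (w' + Θ w') ∈ L' :=
      ⟨Submodule.smul_mem _ _ (Submodule.add_mem _ hw' (hΘW' w' hw')), hP w'⟩
    have hQw' : (2 : ℂ)⁻¹ • (w' - Θ w') ∈ W₁' :=
      ⟨Submodule.smul_mem _ _ (Submodule.sub_mem _ hw' (hΘW' w' hw')), hQ w'⟩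
    have hw_eq : w = (2 : ℂ)⁻¹ • (w + Θ w) + (2 : ℂ)⁻¹ • (w - Θ w) := by module
    have hw'_eq : w' = (2 : ℂ)⁻¹ • (w' + Θ w') + (2 : ℂ)⁻¹ • (w' - Θ w') := by module
    rw [hw_eq, hw'_eq]
    refine Submodule.add_mem _ (Submodule.add_mem _ ?_ ?_) (Submodule.add_mem _ ?_ ?_)
    · exact hspan₁ (hWsplit w hw).1
    · exact hspan₂ (hWsplit w hw).2
    · exact hsub L' fb₂ (fun j => (1, Sum.inr j)) (fun j => by rw [hcbf1]; rfl) _ hPw'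
    · exact hsub W₁' fb₁ (fun i => (1, Sum.inl i)) (fun i => by rw [hcbf1]; rfl) _ hQw'
  -- reindex by `Fin N`
  set cbι := Module.Basis.mk hli hspan with hcbιdef
  set N := Fintype.card ((Σ k, Fin (a k)) ⊕ (Σ k, Fin (b k))) with hN
  set σ : ((Σ k, Fin (a k)) ⊕ (Σ k, Fin (b k))) ≃ Fin N := Fintype.equivFin _ with hσ
  refine ⟨N, cbι.reindex ((Equiv.refl (Fin 2)).prodCongr σ), κ₀ ∘ σ.symm, blk₀ ∘ σ.symm, fun ℓ => ?_, fun ℓ => ?_,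
    fun ℓ => ?_, fun ℓ h => ?_, fun ℓ h => ?_, fun i j => ?_, fun t i j => ?_, fun k => ?_⟩
  · rw [Module.Basis.reindex_apply, Equiv.prodCongr_symm, Equiv.prodCongr_apply, Equiv.refl_symm,
      Equiv.coe_refl, Prod.map_apply, id, hcbιdef, Module.Basis.mk_apply, hcbf0]
    exact heE _
  · rw [Module.Basis.reindex_apply, Equiv.prodCongr_symm, Equiv.prodCongr_apply, Equiv.refl_symm,
      Equiv.coe_refl, Prod.map_apply, id, hcbιdef, Module.Basis.mk_apply, hcbf0]
    exact heW _
  · rw [Module.Basis.reindex_apply, Equiv.prodCongr_symm, Equiv.prodCongr_apply, Equiv.refl_symm,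
      Equiv.coe_refl, Prod.map_apply, id, hcbιdef, Module.Basis.mk_apply, hcbf1]
    exact hfW' _
  · simp only [Module.Basis.reindex_apply, Equiv.prodCongr_symm, Equiv.prodCongr_apply, Equiv.refl_symm,
      Equiv.coe_refl, Prod.map_apply, id, hcbιdef, Module.Basis.mk_apply, hcbf0, hcbf1]
    exact he0 _ h
  · simp only [Module.Basis.reindex_apply, Equiv.prodCongr_symm, Equiv.prodCongr_apply, Equiv.refl_symm,
      Equiv.coe_refl, Prod.map_apply, id, hcbιdef, Module.Basis.mk_apply, hcbf0, hcbf1]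
    exact he1 _ h
  · simp only [Module.Basis.reindex_apply, Equiv.prodCongr_symm, Equiv.prodCongr_apply, Equiv.refl_symm,
      Equiv.coe_refl, Prod.map_apply, id, hcbιdef, Module.Basis.mk_apply, hcbf0, hcbf1, hdual,
      σ.symm.injective.eq_iff]
  · simp only [Module.Basis.reindex_apply, Equiv.prodCongr_symm, Equiv.prodCongr_apply, Equiv.refl_symm,
      Equiv.coe_refl, Prod.map_apply, id, hcbιdef, Module.Basis.mk_apply]
    rcases BlockedTheta.fin2_cases t with rfl | rfl
    · rw [hcbf0, hcbf0]; exact hisoW _ (heW _) _ (heW _)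
    · rw [hcbf1, hcbf1]; exact hisoW' _ (hfW' _) _ (hfW' _)
  · -- the letters of colour `k` span `W_{μ k}`: a `Θ`-graded piece of `W`
    intro x hx
    have hxW : x ∈ W := hKle k hx
    have hPx : (2 : ℂ)⁻¹ • (x + Θ x) ∈ U₁ k :=
      ⟨Submodule.smul_mem _ _ (Submodule.add_mem _ hx (hΘWk k x hx)), hP x⟩
    have hQx : (2 : ℂ)⁻¹ • (x - Θ x) ∈ U₂ k :=
      ⟨Submodule.smul_mem _ _ (Submodule.sub_mem _ hx (hΘWk k x hx)), hQ x⟩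
    have hx_eq : x = (2 : ℂ)⁻¹ • (x + Θ x) + (2 : ℂ)⁻¹ • (x - Θ x) := by module
    have hletter : ∀ s, blk₀ s = k → e s ∈
        Submodule.span ℂ (Set.range fun ℓ : {ℓ : Fin N // (blk₀ ∘ σ.symm) ℓ = k} =>
          (cbι.reindex ((Equiv.refl (Fin 2)).prodCongr σ)) (0, ℓ.1)) := by
      intro s hs
      refine Submodule.subset_span ⟨⟨σ s, by simp [hs]⟩, ?_⟩
      simp only [Module.Basis.reindex_apply, Equiv.prodCongr_symm, Equiv.prodCongr_apply, Equiv.refl_symm,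
        Equiv.coe_refl, Prod.map_apply, id, hcbιdef, Module.Basis.mk_apply, hcbf0, Equiv.symm_apply_apply]
    rw [hx_eq]
    refine Submodule.add_mem _ ?_ ?_
    · refine Submodule.span_le.2 ?_ (hspanU (U₁ k) (b₁ k) _ hPx)
      rintro _ ⟨i, rfl⟩
      exact hletter (Sum.inl ⟨k, i⟩) rfl
    · refine Submodule.span_le.2 ?_ (hspanU (U₂ k) (b₂ k) _ hQx)
      rintro _ ⟨i, rfl⟩
      exact hletter (Sum.inr ⟨k, i⟩) rfl

end TiedDualBases

end HodgeStructure

end Literature.AlgebraicGeometry.Motives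

end
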